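import Mathlib
import Literature.Analysis.FluidPDE.VectorCalculus
import Literature.Analysis.FluidPDE.LeiZhang2011Proofs
import Summits.NavierStokesRegularity.NavierStokesRegularity.Theorems.FilamentSkeletonRssSkeletonEquilibriumKernelIntegrable
import Summits.NavierStokesRegularity.NavierStokesRegularity.Theorems.FilamentSkeletonRssSelectionBoxRJRungPartnerStrain

/-!
# Route `FilamentSkeletonRss` · crux `SelectionBoxRJ` (stmt-NavierStokesRegularity-21220) — rung tools:
# Lipschitz dependence of the regularised Biot–Savart field on the filament, at distance `D`

Lane `ns-filament-19175-p1` (g6); the displacement half of nonlocal brick (N2) of the memo `SIGMA-SCALING-21220.md`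
(item evidence #18, §5), companion of `…RungPartnerStrain` (the strain half).  Helper file
`--supports stmt-NavierStokesRegularity-21220`; route-independent.

In the perturbation scheme for the box (memo §5) the partner filament is an `O(Rb²)`-angle perturbation of the
straight line of rung 0 pivoting at its waist, and one needs the induced field at the OTHER filament (distance
`≥ d√Γ`) to move by `O(Rb²/d)` only.  This is the following kernel estimate:

* `norm_sqrt_sq_add_sub_le` — `|√(r² + e²) − √(s² + e²)| ≤ |r − s|`.
* `inv_cube_sub_mul_le` — `|p⁻³ − q⁻³| q ≤ 3|p − q|/m³` for `0 < m ≤ p, q`.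
* `rosenhead_integrand_lipschitz` — TWO-SIZE pointwise Lipschitz bound (the tree's
  `stub_kernelLipschitzPointwise` has one size for both slots): for `‖T′‖ ≤ 1`, `‖T − T′‖ ≤ θ₁`,
  `‖z − z′‖ ≤ θ₂` and `0 < m ≤ ‖z‖, ‖z′‖`,
  `‖K_e(z) • T × z − K_e(z′) • T′ × z′‖ ≤ θ₁/m² + 4θ₂/m³`.
* `biotSavart_curveLipschitz` — for two filaments `X, X′` with `‖X′′… ‖`: `‖Xᵤ′ − X′ᵤ′‖ ≤ θ` (tangents) and
  `‖X u − X′ u‖ ≤ θ|u − u₀|` (positions, pivot `u₀`), seen from a point `y` at distance `≥ D` from both with linear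
  escape `c|u − u₀| − A ≤ ‖y − X u‖, ‖y − X′ u‖`, the fields differ by at most
  `2πθ (D + A)(cD + 4(D + A))/(c² D³)` (`= O(θ/D)` for `A ≍ D`, `c ≍ 1`), uniformly in the core `e ≠ 0`
  (integrability of each field from `stub_kernelIntegrable`, Cauchy majorant from `cauchy_majorant_core`).

HONEST FRAMING.  Kernel estimates for the rung ladder of a HYPOTHETICAL filament box; nothing here is a claim about
Navier–Stokes regularity or blow-up.
-/

set_option linter.dupNamespace false

noncomputable section

namespace Summit.NavierStokesRegularity.NavierStokesRegularity.Theorems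

open Set Function Filter MeasureTheory Real
open Literature.Analysis.FluidPDE
open Summit.NavierStokesRegularity.NavierStokesRegularity.Theorems.SkeletonEquilibrium.Sketch
open scoped InnerProductSpace Topology

namespace SelectionBoxRJRung

/-- `r ↦ √(r² + e²)` is `1`-Lipschitz: `|√(r² + e²) − √(s² + e²)| ≤ |r − s|` (the Euclidean norms of `(r, e)` and
`(s, e)` differ by at most `‖(r − s, 0)‖`). [folklore] -/
theorem norm_sqrt_sq_add_sub_le (r s e : ℝ) :
    |Real.sqrt (r ^ 2 + e ^ 2) - Real.sqrt (s ^ 2 + e ^ 2)| ≤ |r - s| := by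
  have h1 : Real.sqrt (r ^ 2 + e ^ 2) = ‖(WithLp.toLp 2 ![r, e] : EuclideanSpace ℝ (Fin 2))‖ := by
    rw [EuclideanSpace.norm_eq]; simp [Fin.sum_univ_two]
  have h2 : Real.sqrt (s ^ 2 + e ^ 2) = ‖(WithLp.toLp 2 ![s, e] : EuclideanSpace ℝ (Fin 2))‖ := by
    rw [EuclideanSpace.norm_eq]; simp [Fin.sum_univ_two]
  have h3 : ‖(WithLp.toLp 2 ![r, e] : EuclideanSpace ℝ (Fin 2)) - WithLp.toLp 2 ![s, e]‖ = |r - s| := by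
    have : (WithLp.toLp 2 ![r, e] : EuclideanSpace ℝ (Fin 2)) - WithLp.toLp 2 ![s, e] = WithLp.toLp 2 ![r - s, 0] := by
      ext i; fin_cases i <;> simp
    rw [this, EuclideanSpace.norm_eq]
    simp [Fin.sum_univ_two, Real.sqrt_sq_eq_abs]
  rw [h1, h2, ← h3]
  exact abs_norm_sub_norm_le _ _

/-- `|p⁻³ − q⁻³| q ≤ 3|p − q|/m³` whenever `0 < m ≤ p` and `m ≤ q`
(`p⁻³ − q⁻³ = (q − p)(q² + qp + p²)/(p³q³)`). [folklore] -/
theorem inv_cube_sub_mul_le {m p q : ℝ} (hm : 0 < m) (hmp : m ≤ p) (hmq : m ≤ q) :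
    |(p ^ 3)⁻¹ - (q ^ 3)⁻¹| * q ≤ 3 * |p - q| / m ^ 3 := by
  have hp : 0 < p := hm.trans_le hmp
  have hq : 0 < q := hm.trans_le hmq
  have hid : (p ^ 3)⁻¹ - (q ^ 3)⁻¹ = (q - p) * ((q ^ 2 + q * p + p ^ 2) / (p ^ 3 * q ^ 3)) := by
    field_simp
    ring
  rw [hid, abs_mul, abs_of_pos (by positivity : 0 < (q ^ 2 + q * p + p ^ 2) / (p ^ 3 * q ^ 3)), abs_sub_comm,
    mul_assoc]
  rw [show 3 * |p - q| / m ^ 3 = |p - q| * (3 / m ^ 3) by ring]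
  refine mul_le_mul_of_nonneg_left ?_ (abs_nonneg _)
  rw [div_mul_eq_mul_div, div_le_div_iff₀ (by positivity) (by positivity)]
  -- `m³ (q² + qp + p²) q ≤ 3 p³ q³`
  have h1 : m ^ 3 ≤ p ^ 3 := pow_le_pow_left₀ hm.le hmp 3
  have h2 : m ^ 3 ≤ p ^ 2 * q := by
    calc m ^ 3 = m ^ 2 * m := by ring
      _ ≤ p ^ 2 * q := mul_le_mul (pow_le_pow_left₀ hm.le hmp 2) hmq hm.le (by positivity)
  have h3 : m ^ 3 ≤ p * q ^ 2 := by
    calc m ^ 3 = m * m ^ 2 := by ring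
      _ ≤ p * q ^ 2 := mul_le_mul hmp (pow_le_pow_left₀ hm.le hmq 2) (by positivity) hp.le
  nlinarith [mul_le_mul_of_nonneg_right h1 (by positivity : (0:ℝ) ≤ q ^ 3),
    mul_le_mul_of_nonneg_right h2 (by positivity : (0:ℝ) ≤ q ^ 2 * p),
    mul_le_mul_of_nonneg_right h3 (by positivity : (0:ℝ) ≤ p ^ 2 * q)]

/-- **Two-size pointwise Lipschitz bound for the regularised Biot–Savart integrand.**  For "tangents" `T, T′`
with `‖T′‖ ≤ 1`, `‖T − T′‖ ≤ θ₁` and "chords" `z, z′` with `‖z − z′‖ ≤ θ₂` and a common lower bound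
`0 < m ≤ ‖z‖, ‖z′‖`: `‖K_e(z) • T × z − K_e(z′) • T′ × z′‖ ≤ θ₁/m² + 4θ₂/m³`, uniformly in `e`. [folklore] -/
theorem rosenhead_integrand_lipschitz (e : ℝ) {T T' z z' : EuclideanSpace ℝ (Fin 3)} {θ₁ θ₂ m : ℝ}
    (hT' : ‖T'‖ ≤ 1) (hTT : ‖T - T'‖ ≤ θ₁) (hzz : ‖z - z'‖ ≤ θ₂) (hm : 0 < m)
    (hmz : m ≤ ‖z‖) (hmz' : m ≤ ‖z'‖) :
    ‖((‖z‖ ^ 2 + e ^ 2) ^ (3 / 2 : ℝ))⁻¹ • cross T z - ((‖z'‖ ^ 2 + e ^ 2) ^ (3 / 2 : ℝ))⁻¹ • cross T' z'‖ ≤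
      θ₁ / m ^ 2 + 4 * θ₂ / m ^ 3 := by
  have hz : 0 < ‖z‖ := hm.trans_le hmz
  have hz' : 0 < ‖z'‖ := hm.trans_le hmz'
  set p : ℝ := Real.sqrt (‖z‖ ^ 2 + e ^ 2) with hp
  set q : ℝ := Real.sqrt (‖z'‖ ^ 2 + e ^ 2) with hq
  have hb : 0 < ‖z‖ ^ 2 + e ^ 2 := by positivity
  have hb' : 0 < ‖z'‖ ^ 2 + e ^ 2 := by positivity
  have h32 : ∀ b : ℝ, 0 < b → b ^ (3 / 2 : ℝ) = Real.sqrt b ^ 3 := by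
    intro b hb0
    rw [show (3 / 2 : ℝ) = 1 + 1 / 2 by norm_num, Real.rpow_add hb0, Real.rpow_one, ← Real.sqrt_eq_rpow,
      pow_succ, pow_two, Real.mul_self_sqrt hb0.le]
  have hKp : ((‖z‖ ^ 2 + e ^ 2) ^ (3 / 2 : ℝ))⁻¹ = (p ^ 3)⁻¹ := by rw [h32 _ hb]
  have hKq : ((‖z'‖ ^ 2 + e ^ 2) ^ (3 / 2 : ℝ))⁻¹ = (q ^ 3)⁻¹ := by rw [h32 _ hb']
  have hzp : ‖z‖ ≤ p := by rw [hp]; exact Real.le_sqrt_of_sq_le (le_add_of_nonneg_right (sq_nonneg e))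
  have hzq : ‖z'‖ ≤ q := by rw [hq]; exact Real.le_sqrt_of_sq_le (le_add_of_nonneg_right (sq_nonneg e))
  have hmp : m ≤ p := hmz.trans hzp
  have hmq : m ≤ q := hmz'.trans hzq
  have hppos : 0 < p := hm.trans_le hmp
  have hK0 : 0 ≤ (p ^ 3)⁻¹ := by positivity
  rw [hKp, hKq]
  -- split
  have hdec : (p ^ 3)⁻¹ • cross T z - (q ^ 3)⁻¹ • cross T' z' =
      (p ^ 3)⁻¹ • (cross (T - T') z + cross T' (z - z')) + ((p ^ 3)⁻¹ - (q ^ 3)⁻¹) • cross T' z' := by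
    have h1 : cross (T - T') z = cross T z - cross T' z := by
      have := map_sub crossCLM T T'
      exact congrArg (fun L : EuclideanSpace ℝ (Fin 3) →L[ℝ] EuclideanSpace ℝ (Fin 3) => L z) this
    have h2 : cross T' (z - z') = cross T' z - cross T' z' := map_sub (crossCLM T') z z'
    rw [h1, h2, sub_smul, smul_add, smul_sub, smul_sub]
    abel
  rw [hdec]
  -- first part
  have hA : ‖(p ^ 3)⁻¹ • (cross (T - T') z + cross T' (z - z'))‖ ≤ θ₁ / m ^ 2 + θ₂ / m ^ 3 := by
    rw [norm_smul, Real.norm_of_nonneg hK0]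
    have hc1 : ‖cross (T - T') z‖ ≤ θ₁ * ‖z‖ :=
      (norm_cross_le_norm_mul_norm _ _).trans (mul_le_mul_of_nonneg_right hTT (norm_nonneg _))
    have hc2 : ‖cross T' (z - z')‖ ≤ θ₂ := by
      calc ‖cross T' (z - z')‖ ≤ ‖T'‖ * ‖z - z'‖ := norm_cross_le_norm_mul_norm _ _
        _ ≤ 1 * θ₂ := mul_le_mul hT' hzz (norm_nonneg _) zero_le_one
        _ = θ₂ := one_mul _
    have hθ₁ : 0 ≤ θ₁ := (norm_nonneg _).trans hTT
    have hθ₂ : 0 ≤ θ₂ := (norm_nonneg _).trans hzz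
    have hzp3 : ‖z‖ * m ^ 2 ≤ p ^ 3 := by
      calc ‖z‖ * m ^ 2 ≤ p * p ^ 2 := mul_le_mul hzp (pow_le_pow_left₀ hm.le hmp 2) (sq_nonneg _) hppos.le
        _ = p ^ 3 := by ring
    have hr1 : ‖z‖ / p ^ 3 ≤ 1 / m ^ 2 := by
      rw [div_le_div_iff₀ (by positivity) (by positivity)]; linarith [hzp3]
    have hr2 : θ₂ / p ^ 3 ≤ θ₂ / m ^ 3 :=
      div_le_div_of_nonneg_left hθ₂ (by positivity) (pow_le_pow_left₀ hm.le hmp 3)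
    calc (p ^ 3)⁻¹ * ‖cross (T - T') z + cross T' (z - z')‖
        ≤ (p ^ 3)⁻¹ * (θ₁ * ‖z‖ + θ₂) := mul_le_mul_of_nonneg_left (norm_add_le_of_le hc1 hc2) hK0
      _ = θ₁ * (‖z‖ / p ^ 3) + θ₂ / p ^ 3 := by ring
      _ ≤ θ₁ * (1 / m ^ 2) + θ₂ / m ^ 3 := add_le_add (mul_le_mul_of_nonneg_left hr1 hθ₁) hr2
      _ = θ₁ / m ^ 2 + θ₂ / m ^ 3 := by ring
  -- second part
  have hB : ‖((p ^ 3)⁻¹ - (q ^ 3)⁻¹) • cross T' z'‖ ≤ 3 * θ₂ / m ^ 3 := by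
    rw [norm_smul, Real.norm_eq_abs]
    have hc3 : ‖cross T' z'‖ ≤ q := by
      calc ‖cross T' z'‖ ≤ ‖T'‖ * ‖z'‖ := norm_cross_le_norm_mul_norm _ _
        _ ≤ 1 * ‖z'‖ := mul_le_mul_of_nonneg_right hT' (norm_nonneg _)
        _ = ‖z'‖ := one_mul _
        _ ≤ q := hzq
    have hpq : |p - q| ≤ θ₂ := by
      calc |p - q| ≤ |‖z‖ - ‖z'‖| := norm_sqrt_sq_add_sub_le ‖z‖ ‖z'‖ e
        _ ≤ ‖z - z'‖ := abs_norm_sub_norm_le z z'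
        _ ≤ θ₂ := hzz
    calc |(p ^ 3)⁻¹ - (q ^ 3)⁻¹| * ‖cross T' z'‖ ≤ |(p ^ 3)⁻¹ - (q ^ 3)⁻¹| * q :=
          mul_le_mul_of_nonneg_left hc3 (abs_nonneg _)
      _ ≤ 3 * |p - q| / m ^ 3 := inv_cube_sub_mul_le hm hmp hmq
      _ ≤ 3 * θ₂ / m ^ 3 := by gcongr
  calc _ ≤ (θ₁ / m ^ 2 + θ₂ / m ^ 3) + 3 * θ₂ / m ^ 3 := norm_add_le_of_le hA hB
    _ = θ₁ / m ^ 2 + 4 * θ₂ / m ^ 3 := by ring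

/-- **Lipschitz dependence of the regularised Biot–Savart field on the filament, seen from distance `D`.**
Two `C¹` filaments `X, X'` with `‖X′‖, ‖X'′‖ ≤ 1` and linear growth from the origin (for integrability), whose tangents
differ by `≤ θ` and whose positions differ by `≤ θ|u − u₀|` (pivot `u₀`); a point `y` at distance `≥ D > 0` from both,
with linear escape `c|u − u₀| − A ≤ ‖y − X u‖, ‖y − X' u‖` (`c > 0`, `A ≥ 0`).  Then the two fields at `y` differ by
at most `2πθ(D + A)(cD + 4(D + A))/(c² D³)`, uniformly in the core `e ≠ 0`. [folklore] -/
theorem biotSavart_curveLipschitz {e c₀ C C' c D A u₀ θ : ℝ} {X X' : ℝ → EuclideanSpace ℝ (Fin 3)}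
    {y : EuclideanSpace ℝ (Fin 3)} (he : e ≠ 0) (hc₀ : 0 < c₀)
    (hX : ContDiff ℝ 1 X) (hdX : ∀ u, ‖deriv X u‖ ≤ 1) (hgrow : ∀ u, c₀ * |u| - C ≤ ‖X u‖)
    (hX' : ContDiff ℝ 1 X') (hdX' : ∀ u, ‖deriv X' u‖ ≤ 1) (hgrow' : ∀ u, c₀ * |u| - C' ≤ ‖X' u‖)
    (hθ : 0 ≤ θ) (htan : ∀ u, ‖deriv X u - deriv X' u‖ ≤ θ) (hpos : ∀ u, ‖X u - X' u‖ ≤ θ * |u - u₀|)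
    (hc : 0 < c) (hD : 0 < D) (hA : 0 ≤ A)
    (hfar : ∀ u, D ≤ ‖y - X u‖) (hfar' : ∀ u, D ≤ ‖y - X' u‖)
    (hesc : ∀ u, c * |u - u₀| - A ≤ ‖y - X u‖) (hesc' : ∀ u, c * |u - u₀| - A ≤ ‖y - X' u‖) :
    ‖(∫ u : ℝ, ((‖y - X u‖ ^ 2 + e ^ 2) ^ (3 / 2 : ℝ))⁻¹ • cross (deriv X u) (y - X u)) -
        ∫ u : ℝ, ((‖y - X' u‖ ^ 2 + e ^ 2) ^ (3 / 2 : ℝ))⁻¹ • cross (deriv X' u) (y - X' u)‖ ≤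
      2 * Real.pi * θ * (D + A) * (c * D + 4 * (D + A)) / (c ^ 2 * D ^ 3) := by
  have hI := stub_kernelIntegrable e c₀ C X he hc₀ hX hdX hgrow y
  have hI' := stub_kernelIntegrable e c₀ C' X' he hc₀ hX' hdX' hgrow' y
  rw [← integral_sub hI hI']
  have hDA : 0 < D + A := by linarith
  set k : ℝ := c / (D + A) with hk
  have hkpos : 0 < k := div_pos hc hDA
  -- constant in front of the Cauchy majorant
  set L : ℝ := θ * (1 + 4 * (D + A) / (c * D)) * (2 / D ^ 2) with hL
  have hL0 : 0 ≤ L := by rw [hL]; positivity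
  set g : ℝ → ℝ := fun u => L * (1 + (k * (u - u₀)) ^ 2)⁻¹ with hg
  have hg_int : Integrable g := by
    have h0 : Integrable (fun u : ℝ => (1 + (k * u) ^ 2)⁻¹) :=
      integrable_inv_one_add_sq.comp_mul_left' hkpos.ne'
    exact (h0.comp_sub_right u₀).const_mul _
  have hg_val : ∫ u, g u = L * ((D + A) / c * Real.pi) := by
    rw [hg, integral_const_mul]
    congr 1
    have h1 : ∫ u : ℝ, (1 + (k * (u - u₀)) ^ 2)⁻¹ = ∫ u : ℝ, (1 + (k * u) ^ 2)⁻¹ :=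
      integral_sub_right_eq_self (fun u : ℝ => (1 + (k * u) ^ 2)⁻¹) u₀
    rw [h1, Measure.integral_comp_mul_left (fun y : ℝ => (1 + y ^ 2)⁻¹), integral_univ_inv_one_add_sq,
      smul_eq_mul, hk, inv_div, abs_of_pos (div_pos hDA hc)]
  have hbound : ∀ u : ℝ,
      ‖((‖y - X u‖ ^ 2 + e ^ 2) ^ (3 / 2 : ℝ))⁻¹ • cross (deriv X u) (y - X u) -
          ((‖y - X' u‖ ^ 2 + e ^ 2) ^ (3 / 2 : ℝ))⁻¹ • cross (deriv X' u) (y - X' u)‖ ≤ g u := by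
    intro u
    -- common lower bound `m = max D (c|u-u₀| - A)`
    set m : ℝ := max D (c * |u - u₀| - A) with hm
    have hm0 : 0 < m := lt_max_of_lt_left hD
    have hmD : D ≤ m := le_max_left _ _
    have hme : c * |u - u₀| - A ≤ m := le_max_right _ _
    have hmz : m ≤ ‖y - X u‖ := max_le (hfar u) (hesc u)
    have hmz' : m ≤ ‖y - X' u‖ := max_le (hfar' u) (hesc' u)
    have hzz : ‖(y - X u) - (y - X' u)‖ ≤ θ * |u - u₀| := by
      rw [show (y - X u) - (y - X' u) = -(X u - X' u) by abel, norm_neg]; exact hpos u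
    have h1 := rosenhead_integrand_lipschitz e (hdX' u) (htan u) hzz hm0 hmz hmz'
    -- `θ/m² + 4θ|u-u₀|/m³ ≤ θ(1 + 4(D+A)/(cD))/m²`
    have hu : |u - u₀| ≤ (m + A) / c := by rw [le_div_iff₀ hc]; linarith
    have h2 : θ / m ^ 2 + 4 * (θ * |u - u₀|) / m ^ 3 ≤ θ * (1 + 4 * (D + A) / (c * D)) / m ^ 2 := by
      have hmA : (m + A) / (c * m) ≤ (D + A) / (c * D) := by
        rw [div_le_div_iff₀ (by positivity) (by positivity)]
        nlinarith [mul_nonneg hA (sub_nonneg.2 hmD), hc]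
      have step : 4 * (θ * |u - u₀|) / m ^ 3 ≤ 4 * θ * ((D + A) / (c * D)) / m ^ 2 := by
        calc 4 * (θ * |u - u₀|) / m ^ 3 ≤ 4 * (θ * ((m + A) / c)) / m ^ 3 := by gcongr
          _ = 4 * θ * ((m + A) / (c * m)) / m ^ 2 := by field_simp
          _ ≤ 4 * θ * ((D + A) / (c * D)) / m ^ 2 := by gcongr
      calc θ / m ^ 2 + 4 * (θ * |u - u₀|) / m ^ 3 ≤ θ / m ^ 2 + 4 * θ * ((D + A) / (c * D)) / m ^ 2 := by
            linarith [step]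
        _ = θ * (1 + 4 * (D + A) / (c * D)) / m ^ 2 := by field_simp
    -- Cauchy majorant for `1/m²`
    have hcore := cauchy_majorant_core (u := u) (u₀ := u₀) hD hA hc hmD hme
    have h3 : θ * (1 + 4 * (D + A) / (c * D)) / m ^ 2 ≤ g u := by
      show θ * (1 + 4 * (D + A) / (c * D)) / m ^ 2 ≤ L * (1 + (k * (u - u₀)) ^ 2)⁻¹
      have hkq : k * (u - u₀) = c * (u - u₀) / (D + A) := by rw [hk]; ring
      rw [hkq, hL]
      have hq : 0 < 1 + (c * (u - u₀) / (D + A)) ^ 2 := by positivity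
      rw [div_le_iff₀ (pow_pos hm0 2), mul_assoc, mul_assoc, mul_assoc]
      refine mul_le_mul_of_nonneg_left ?_ hθ
      rw [← mul_assoc, show (1 + 4 * (D + A) / (c * D)) * (2 / D ^ 2) * ((1 + (c * (u - u₀) / (D + A)) ^ 2)⁻¹ * m ^ 2)
          = (1 + 4 * (D + A) / (c * D)) * (2 * m ^ 2 / (D ^ 2 * (1 + (c * (u - u₀) / (D + A)) ^ 2))) by
            field_simp]
      refine le_mul_of_one_le_right (by positivity) ?_
      rw [one_le_div (by positivity)]
      exact hcore
    exact h1.trans (h2.trans h3)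
  have hfin : L * ((D + A) / c * Real.pi) = 2 * Real.pi * θ * (D + A) * (c * D + 4 * (D + A)) / (c ^ 2 * D ^ 3) := by
    rw [hL]; field_simp
  calc _ ≤ ∫ u, g u := norm_integral_le_of_norm_le hg_int (Eventually.of_forall hbound)
    _ = L * ((D + A) / c * Real.pi) := hg_val
    _ = _ := hfin

end SelectionBoxRJRung

end Summit.NavierStokesRegularity.NavierStokesRegularity.Theorems
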